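import Literature.Barriers.CriticalPhenomena.KozmaNachmiasVolumeTail
import Literature.Probability.FitznerVanDerHofstad2017.MeanFieldOfTriangle
import Literature.Barriers.CriticalPhenomena.LaceExpansionXSpaceAsymptoticsProofs
import HarnessLib

/-!
# `η = 0` in `x`-space ⟹ the triangle condition iff `d ≥ 7`; the `x`-space lace route to
# mean-field behaviour for `d ≥ 11` from ONE named input

CITATION HEADER. Sources: M. Heydenreich, R. van der Hofstad, *Progress in high-dimensional
percolation and random graphs* (2017) (bib key `HeydenreichVanDerHofstad2017`): Thm. 11.4 (11.2.3)
(`τ_{p_c}(x) = A₂|x|^{2-d}(1 + O(|x|^{-2/d}))`, `d ≥ 11`), (1.2.3)/(1.2.14) (bounded-ratio sense),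
proof of Cor. 5.2 ((5.1.12), p. 56: the triangle "is finite if (and only if) `d > 2n`", `n = 3`);
T. Hara, Ann. Probab. 36 (2008) (bib key `Hara2008`), Thm. 1.1 and §1.2 (framework); T. Hara,
R. van der Hofstad, G. Slade, Ann. Probab. 31 (2003) (`HaraHofstadSlade2003`), p. 5 and Prop. 1.7(i)
(two-point decay `|x|^{-(d-2)}` ⟹ triangle condition for `d > 6`); M. Aizenman, *On the number of
incipient spanning clusters* (1997), §5 condition (t-c) (`Aizenman1997`); R. Fitzner, R. van der
Hofstad, EJP 22 (2017), Cor. 1.3 (`FitznerVanDerHofstad2017`). Origin: build `lace`, unit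
`b2b-lace-dmps-g4`. Companions: `LaceExpansionHighDimension.lean` (the barrier's objects
`EtaZeroXSpace`, `TwoPointBoundedRatio`, the named fact `Hara2008_etaZeroXSpace`, and the NEGATIVE
direction `TwoPointBoundedRatio.seven_le_of_triangle`, `EtaZeroXSpace.seven_le_of_triangle`,
`not_triangleCondition_of_twoPoint_lower`), `KozmaNachmiasVolumeTail.lean` (the positive direction
`TwoPointBoundedRatio.triangleCondition` at the integer exponent `d - 2`, by discrete Riesz
convolution bounds), `LaceExpansionXSpaceAsymptotics(Proofs).lean` (Hara's
framework; `Hara2008_etaZeroXSpace_of_laceExpansionPc`: the Gaussian lemma PROVED, the single open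
input `Hara2008_laceExpansionPc`), `Literature.Probability.Percolation.XSpaceDecayTriangle` (the
positive half `triangleCondition_of_twoPoint_upper`: `x`-space decay with `3a > 2d` ⟹ triangle),
`Literature.Probability.FitznerVanDerHofstad2017.MeanFieldOfTriangle` (`meanField_of_triangle`).

WHAT IS PROVED (kernel; the only named facts appear as explicit hypotheses `(h : X)`).

* `TwoPointBoundedRatio.triangleCondition_iff`: under Aizenman's (t-c) with `η = 0` —
  `C'‖x-y‖^{2-d} ≤ τ_{p_c}(x,y) ≤ C‖x-y‖^{2-d}` for `x ≠ y` — the triangle condition holds IF AND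
  ONLY IF `d ≥ 7`: the "only if" is the barrier's `seven_le_of_triangle` (divergence for
  `3(d-2) ≤ 2d`), the "if" is the tree's `TwoPointBoundedRatio.triangleCondition`
  (`KozmaNachmiasVolumeTail.lean`, Riesz convolution bounds at the integer exponent `d - 2`;
  equivalently the case `a = d - 2` of `triangleCondition_of_twoPoint_upper`, which also covers the
  non-integer exponents `d - 2 - ε` of near-critical inputs). The biconditional is the
  `x`-space counterpart of "the right-hand side of (5.1.12) is finite if (and only if) `d > 2n`",
  `n = 3`, announced in `LaceExpansionHighDimension.lean`.
* `EtaZeroXSpace.triangleCondition`, `….triangleCondition_iff` (`d ≥ 2`), `….meanField`: the same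
  from the printed asymptotics (11.2.3) (via `EtaZeroXSpace.twoPointBoundedRatio` and
  `τ_{p_c} > 0`), and then `MeanField d` (`θ(p_c) = 0`, `γ = 1`, `β = 1`, `δ = 2` bounded-ratio).
* `triangleCondition_of_Hara2008_etaZeroXSpace`, `meanField_of_Hara2008_etaZeroXSpace`: the named
  fact "`η = 0` in `x`-space for `d ≥ 11`" (Heydenreich–van der Hofstad Thm. 11.4 / Hara 2008
  Thm. 1.1) gives the triangle condition and mean-field behaviour for every `d ≥ 11`.
* `triangleCondition_of_Hara2008_laceExpansionPc`, `meanField_of_Hara2008_laceExpansionPc`: THE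
  `x`-SPACE LACE ROUTE — the single named input `Hara2008_laceExpansionPc` (Hara 2008, Prop. 1.2 at
  `p_c` with the bootstrap bound on `Π_{p_c}`, `d ≥ 11` via the NoBLE) gives `MeanField d` for
  `d ≥ 11`, the Gaussian lemma (`Hara2008_gaussianConvolution_holds`) and everything downstream
  being kernel theorems. This parallels the `k`-space route
  `HaraSlade1990_triangleCondition_of_laceFacts` (infrared bound ⟹ triangle) with a disjoint
  analytic middle: no Fourier-space triangle integral `∫ D̂² Ĉ³`, only `x`-space decay.

No statement of the sources is altered: all objects are the tree's (`TriangleCondition`,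
`EtaZeroXSpace`, `TwoPointBoundedRatio`, `MeanField`, `Hara2008_etaZeroXSpace`,
`Hara2008_laceExpansionPc`).
-/

noncomputable section

namespace Literature.Barriers.CriticalPhenomena

open Literature.Probability.LatticeModels
open Literature.Probability.Percolation
open Literature.Probability.FitznerVanDerHofstad2017 (MeanField meanField_of_triangle)

variable {d : ℕ}

/-! ### Bounded ratio ⟹ triangle iff `d ≥ 7` -/

/-- **(t-c) with `η = 0` ⟹ (`T(p_c) < ∞ ⟺ d ≥ 7`)** (`d ≥ 1`): the "only if" is the barrier's
`TwoPointBoundedRatio.seven_le_of_triangle` (annulus blocks make the triangle diverge when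
`3(d-2) ≤ 2d`), the "if" is `TwoPointBoundedRatio.triangleCondition`.
[cite: HeydenreichVanDerHofstad2017, proof of Cor. 5.2 (p. 56: "finite if (and only if) d > 2n", n = 3)]
[cite: Aizenman1997, §5 (condition (t-c) with η = 0)] -/
theorem TwoPointBoundedRatio.triangleCondition_iff [NeZero d] (hτ : TwoPointBoundedRatio d) :
    TriangleCondition d ↔ 7 ≤ d :=
  ⟨fun hT => hτ.seven_le_of_triangle hT, fun hd => TwoPointBoundedRatio.triangleCondition hd hτ⟩

/-- **(t-c) with `η = 0` ⟹ mean-field behaviour for `d ≥ 7`**: `MeanField d` (`θ(p_c) = 0`, `γ = 1`,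
`β = 1`, `δ = 2` in the bounded-ratio sense) by the triangle condition and Fitzner–van der Hofstad
Cor. 1.3 (`meanField_of_triangle`). [cite: FitznerVanDerHofstad2017, Cor. 1.3]
[cite: HeydenreichVanDerHofstad2017, Thm. 4.1 and p. 48] -/
theorem TwoPointBoundedRatio.meanField (hτ : TwoPointBoundedRatio d) (hd : 7 ≤ d) : MeanField d :=
  meanField_of_triangle (by omega) (TwoPointBoundedRatio.triangleCondition hd hτ)

/-! ### The printed asymptotics (11.2.3) -/

/-- **`η = 0` in `x`-space (11.2.3) ⟹ `T(p_c) < ∞` for `d ≥ 7`** (through the bounded-ratio sense,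
`EtaZeroXSpace.twoPointBoundedRatio`, using `τ_{p_c} > 0`).
[cite: HeydenreichVanDerHofstad2017, Thm. 11.4 (11.2.3) and (5.1.12)] [cite: HaraHofstadSlade2003, p. 5] -/
theorem EtaZeroXSpace.triangleCondition (hη : EtaZeroXSpace d) (hd : 7 ≤ d) :
    TriangleCondition d :=
  TwoPointBoundedRatio.triangleCondition hd
    (hη.twoPointBoundedRatio (by omega) fun x => tau_criticalProbI_pos (by omega) 0 x)

/-- **(11.2.3) ⟹ (`T(p_c) < ∞ ⟺ d ≥ 7`)** on `ℤ^d`, `d ≥ 2`. With `EtaZeroXSpace.seven_le_of_triangle`.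
[cite: HeydenreichVanDerHofstad2017, Thm. 11.4 and proof of Cor. 5.2 (p. 56)] -/
theorem EtaZeroXSpace.triangleCondition_iff (hη : EtaZeroXSpace d) (hd : 2 ≤ d) :
    TriangleCondition d ↔ 7 ≤ d :=
  ⟨fun hT => hη.seven_le_of_triangle hd hT, fun h7 => hη.triangleCondition h7⟩

/-- **(11.2.3) ⟹ mean-field behaviour for `d ≥ 7`.** [cite: FitznerVanDerHofstad2017, Cor. 1.3]
[cite: HeydenreichVanDerHofstad2017, Thm. 11.4 and Thm. 4.1] -/
theorem EtaZeroXSpace.meanField (hη : EtaZeroXSpace d) (hd : 7 ≤ d) : MeanField d :=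
  meanField_of_triangle (by omega) (hη.triangleCondition hd)

/-! ### From the named fact `Hara2008_etaZeroXSpace` and from the lace input alone -/

/-- The named fact "`η = 0` in `x`-space for `d ≥ 11`" (Heydenreich–van der Hofstad Thm. 11.4 /
Hara 2008 Thm. 1.1 with the NoBLE extension) gives the triangle condition for every `d ≥ 11` — an
`x`-space derivation of Cor. 5.2's conclusion at the current dimension floor.
[cite: HeydenreichVanDerHofstad2017, Thm. 11.4 and Cor. 5.2] [cite: Hara2008, Thm. 1.1 and Remark 1(ii)] -/
theorem triangleCondition_of_Hara2008_etaZeroXSpace (h : Hara2008_etaZeroXSpace) (hd : 11 ≤ d) :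
    TriangleCondition d :=
  (h d hd).triangleCondition (by omega)

/-- … and `MeanField d` for every `d ≥ 11`. [cite: FitznerVanDerHofstad2017, Cor. 1.3]
[cite: HeydenreichVanDerHofstad2017, Thm. 11.4] -/
theorem meanField_of_Hara2008_etaZeroXSpace (h : Hara2008_etaZeroXSpace) (hd : 11 ≤ d) :
    MeanField d :=
  (h d hd).meanField (by omega)

/-- **THE `x`-SPACE LACE ROUTE, one named input.** `Hara2008_laceExpansionPc` (Hara 2008, Prop. 1.2
at `p = p_c`: the Fourier representation of `τ_{p_c}` with `Ĵ = 2dpD̂(1 + Π̂)`, `ĝ = 1 + Π̂`, the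
infrared lower bound on `Ĵ(0) - Ĵ(k)`, and the `x`-space bound `|Π_{p_c}(x)| ≤ c⟦x⟧^{-2(d-2)}` for
`d ≥ 11`) ⟹ `T(p_c) < ∞` for every `d ≥ 11`: Hara's Gaussian lemma is proved
(`Hara2008_gaussianConvolution_holds`), giving (11.2.3) (`Hara2008_etaZeroXSpace_of_laceExpansionPc`),
then `EtaZeroXSpace.triangleCondition`. [cite: Hara2008, Prop. 1.2 and §1.2]
[cite: HeydenreichVanDerHofstad2017, Thm. 11.4 and pp. 137–139] -/
theorem triangleCondition_of_Hara2008_laceExpansionPc (hP : Hara2008_laceExpansionPc)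
    (hd : 11 ≤ d) : TriangleCondition d :=
  triangleCondition_of_Hara2008_etaZeroXSpace (Hara2008_etaZeroXSpace_of_laceExpansionPc hP) hd

/-- **The `x`-space lace route to mean-field behaviour**: `Hara2008_laceExpansionPc` ⟹ `MeanField d`
for every `d ≥ 11` — parallel to the `k`-space route (infrared bound ⟹ triangle,
`HaraSlade1990_triangleCondition_of_laceFacts`) with a disjoint analytic middle (Gaussian lemma and
`x`-space decay instead of the Fourier-space triangle integral).
[cite: Hara2008, Thm. 1.1 and §1.2] [cite: FitznerVanDerHofstad2017, Cor. 1.3] -/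
theorem meanField_of_Hara2008_laceExpansionPc (hP : Hara2008_laceExpansionPc) (hd : 11 ≤ d) :
    MeanField d :=
  meanField_of_Hara2008_etaZeroXSpace (Hara2008_etaZeroXSpace_of_laceExpansionPc hP) hd

end Literature.Barriers.CriticalPhenomena

end
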